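import Summits.Ventures.AbcSig.Rows.XTemplateC2a
import Summits.Ventures.AbcSig.Levels.N349
import Summits.Ventures.AbcSig.Levels.N698

/-!
# Venture AbcSig — ROW `C2aL349A6`: `xⁿ + 2^a·349^m·yⁿ = z²`, class `a ≥ 6` (levels 349 (norm form) and 698 (tree)) — GENERATED by p-lean g4 `gen4/a6row.py`

HONEST FRAMING. A row of a COMPUTATION cell (`pub-abcsig`); a CONDITIONAL theorem, no claim on ABC or any summit.
Hypotheses: `BS04Package` (CITED); `DataComplete 349` + `RefinesCPSymAll 349` (COMPUTED: norm-form level file `Levels/N349.lean` built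
from the engine-1 characteristic polynomials — the big orbits of this prime level have no small-prime θ-coordinates, so the ordinary
ℤ[θ] certificates were never possible) and `DataComplete 698` (tree);
the listed per-orbit exclusions `hX_…` (CITED: the row of record's module closures). `a = 6` uses both levels (case (v₆)), `a ≥ 7` the
level 698 only. Exponent range: prime `n ≥ 11`, `n ≠ 349`, n ∉ [11]; `6 ≤ a < n`, `1 ≤ m < n`.
Residual of record R = {11} EXCLUDED in the statement (hres). CITED per the row of record's R3 at level 349: 349.2 @ 29: M6. Level 698 (tree): no cited residue.
Row of record: `census/rows/C2a/C2a-l349-a6plus.md` (sha16 `395b707e6c317915`; SIGNED 2026-08-22T09:50:52Z by referee (ref-g5)).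
-/

namespace Summit.Ventures.AbcSig

/-- Row `C2aL349A6`: class `a ≥ 6`, first distribution, prime `n ≥ 11`, `n ≠ 349`, `n ∉ [11]`; conditional on the named hypotheses. -/
theorem xrow_C2aL349A6 (M : NewformModel) (hP : M.BS04Package)
    (hD349 : M.DataComplete 349 level349Orbits) (hCP349 : M.RefinesCPSymAll 349 level349CP)
    (hD698 : M.DataComplete 698 level698Orbits)
    (n : ℕ) (hn : n.Prime) (hmin : 11 ≤ n) (hnℓ : n ≠ 349) (hres : n ∉ ([11] : List ℕ)) (a m : ℕ) (ha : 6 ≤ a) (hm : 1 ≤ m) (han : a < n) (hmn : m < n)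
    (hX_orbit_349_2 : n ∈ ([29] : List ℕ) → M.Excludes 349 orbit_349_2 (famB (2 ^ a * 349 ^ m) n (fun _ _ => True)))
    (x y z : ℤ) (hxy1 : x * y ≠ 1) (hxy2 : x * y ≠ -1) : ¬ IsPrimitiveSolution 1 (2 ^ a * 349 ^ m) 1 n x y z := by
  have hℓ : Nat.Prime 349 := by norm_num
  have h7 : 7 ≤ n := by omega
  have hS1 :=
    (level349_sieve M hP hCP349 n hn h7 (fun o => M.Excludes 349 o (famB (2 ^ a * 349 ^ m) n (fun _ _ => True)) ∨ M.ExcludesStd 349 o n) (fun _ h => Or.inr h) (fun hmem => by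
      rcases (by simpa using hmem : n = 7 ∨ n = 29) with rfl | rfl
      · omega
      · exact Or.inl (hX_orbit_349_2 (by simp))))
  have hS2 :=
    (level698_sieve n hn h7 (fun o => M.Excludes 698 o (famB (2 ^ a * 349 ^ m) n (fun _ _ => True)) ∨ M.ExcludesStd 698 o n) (fun hmem => by
      obtain rfl : n = 7 := by simpa using hmem
      omega) (fun hmem => by
      obtain rfl : n = 7 := by simpa using hmem
      omega) (fun hmem => by
      rcases (by simpa using hmem : n = 7 ∨ n = 11) with rfl | rfl
      · omega
      · exact absurd (by simp) hres))
  by_cases ha6 : a = 6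
  · subst ha6
    exact xrowC2a_a6 349 hℓ (by norm_num) M hP n hn h7 hnℓ hD349 hD698 m hm hmn hS1 hS2 x y z hxy1 hxy2
  · exact xrowC2a_age7 349 hℓ (by norm_num) M hP n hn h7 hnℓ hD698 a m (by omega) hm han hmn hS2 x y z hxy1 hxy2

end Summit.Ventures.AbcSig
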